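import Summits.ResolutionOfSingularities.ResolutionOfSingularities.Theorems.EquisingularLiftEquisingularLiftBlowupModelThree
import Summits.ResolutionOfSingularities.ResolutionOfSingularities.Theorems.PAlterationPicoverKernelReduction
import Literature.AlgebraicGeometry.Resolution.AlterationsDimension
import Literature.AlgebraicGeometry.Resolution.AffineDomainEquidim
import Literature.AlgebraicGeometry.Resolution.ExcellentRingsFieldProofs
import Mathlib.RingTheory.KrullDimension.Regular
import HarnessLib

/-!
# Crux `EquisingularLift` (stmt-ResolutionOfSingularities-15660), line `Sketch`, skeleton v10:
# stub `stub_blowupModel_four` — regular projective blow-up models of integral threefolds in `ℙ⁴_k`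

[OURS · L1 W4.5b] AI-produced, weaker than expert review; NOT a statement of any manuscript.

The `n = 4` downstairs residual of the LINEAR-CENTRE reduction (lead `res-L1-w45b-lead-1`, skeleton v10,
stub (3)): every integral closed subscheme `H ⊆ ℙ⁴_k` with locally principal ideal (an integral threefold
HYPERSURFACE, or `ℙ⁴_k` itself — the typing allows the zero ideal) carries a non-zero ideal sheaf `𝔞` ALL of
whose blow-ups are regular, CONDITIONALLY on the two named facts of the tree
`CossartPiltant2019General` (Cossart–Piltant 2019, Thm. 1.1 (i)(ii)) and `CossartPiltant2019Principalization`
(Cossart–Piltant 2019, Prop. 4.4), taken as hypotheses and never asserted (landed as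
`stub_blowupModel_four_of_CP`; after the two fact binders the type is the registered signature verbatim).

Proof.
* `ι` an isomorphism: `H ≅ ℙ⁴_k` is regular (`isRegular_projectiveSpace`) and `𝔞 = ⊤` works
  (`exists_blowupModel_of_isRegular`, file `…BlowupModelThree`).
* Otherwise `H` is a HYPERSURFACE OF DIMENSION EXACTLY `3` (`topologicalKrullDim_of_hypersurface`, the new
  ingredient of this file): pick a point `x ∈ H` and an affine open `U ∋ ι x` of `ℙ⁴_k` on which the ideal of
  `H` is generated by one section `g`; then `Γ(H, ι⁻¹U) ≅ Γ(ℙ⁴, U) ⧸ (g)` (closed immersions are surjective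
  on affine sections, `Scheme.Hom.app_surjective`, with kernel `ι.ker.ideal U`, `Scheme.Hom.ker_apply`),
  `Γ(ℙ⁴, U)` is an affine `k`-domain of dimension `dim ℙ⁴_k = 4` (`topologicalKrullDim_eq_ringKrullDim_of_isAffineOpen`,
  Görtz–Wedhorn I Thm. 5.22), `g ≠ 0` (else `dim H = 4`, but a proper closed subscheme of `ℙ⁴_k` has
  dimension `< 4`) and `g` is not a unit (`ι⁻¹U ∋ x` is non-empty), so Krull's principal ideal theorem with
  the equidimensionality of affine domains (`height_eq_ringKrullDim_of_isMaximal`, Matsumura Thm. 5.6 / Ex. 5.1;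
  Mathlib `Module.ringKrullDim_quotient_add_one_of_mem_nonZeroDivisors`) gives `dim Γ(ℙ⁴, U) ⧸ (g) = 3`, and
  `dim H` is computed on the non-empty affine open `ι⁻¹U`.
  Then the tree theorem `Picover.KernelReduction.admitsDesingularization_of_dim_three` (CP Thm. 1.1 ⇒ a
  resolution which is an isomorphism over `Reg H`; Raynaud–Gruson domination, PROVED in the tree; CP Prop. 4.4
  principalization; Stacks 080B) yields ONE blow-up `T → H` along some `𝔞` co-supported in `Sing H` with `T`
  regular; `𝔞 ≠ ⊥` because the generic point of `H` is regular, and every blow-up of `𝔞` is isomorphic to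
  `T` (`IsBlowup.unique`) — `blowupModel_of_admitsDesingularization`.

No use is made of `CharP`, `IsAlgClosed` or `p`. References: [CossartPiltant2019, Thm. 1.1, Prop. 4.4];
[StacksProject, Tags 081T, 080B, 02OS]; [GortzWedhorn2020, Thm. 5.22]; [Matsumura1987, §5 Thm. 5.6, Ex. 5.1].
-/

set_option linter.dupNamespace false -- mandated namespace `Summit.<Summit>.<Problem>` of this single-conjunct summit

noncomputable section

open CategoryTheory CategoryTheory.Limits AlgebraicGeometry TopologicalSpace Topology
open Literature.AlgebraicGeometry.Resolution Literature.AlgebraicGeometry.Motives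

universe u

namespace Summit.ResolutionOfSingularities.ResolutionOfSingularities.Cruxes.EquisingularLift.StrataSplit

/-! ## A hypersurface section of an affine domain has dimension one less -/

/-- **Krull's principal ideal theorem for affine domains, dimension form**: for a domain `A` of finite type
over a field `k` with `dim A = d + 1` and a non-zero non-unit `t ∈ A`, `dim A ⧸ (t) = d` (`t` is a
non-zero-divisor inside a maximal ideal, which has height `dim A` by equidimensionality of affine domains).
[cite: Matsumura1987, §5 Thm. 5.6 and Ex. 5.1] -/
theorem ringKrullDim_quotient_span_singleton_eq_of_finiteType (k : Type u) {A : Type u} [Field k]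
    [CommRing A] [IsDomain A] [Algebra k A] [Algebra.FiniteType k A] (d : ℕ)
    (hdim : ringKrullDim A = ((d + 1 : ℕ) : WithBot ℕ∞)) {t : A} (ht0 : t ≠ 0) (htu : ¬ IsUnit t) :
    ringKrullDim (A ⧸ Ideal.span {t}) = (d : WithBot ℕ∞) := by
  haveI : IsNoetherianRing A := Algebra.FiniteType.isNoetherianRing k A
  obtain ⟨m, hm, htm⟩ := Ideal.exists_le_maximal (Ideal.span {t}) (Ideal.span_singleton_ne_top htu)
  have htm' : t ∈ m := htm (Ideal.mem_span_singleton_self t)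
  have hh : (m.height : WithBot ℕ∞) = ringKrullDim A := height_eq_ringKrullDim_of_isMaximal k m
  have h := Module.ringKrullDim_quotient_add_one_of_mem_nonZeroDivisors
    (mem_nonZeroDivisors_of_ne_zero ht0) hh htm'
  rw [hdim, Nat.cast_add, Nat.cast_one] at h
  exact ENat.WithBot.add_one_cancel.mp h

/-! ## Integral hypersurfaces of `ℙⁿ⁺¹_k` have dimension `n` -/

/-- **An integral hypersurface of `ℙⁿ⁺¹_k` has dimension `n`.** Let `ι : H ↪ ℙⁿ⁺¹_k` (`k` a field) be a closed
immersion of an integral scheme whose ideal is locally principal (every point of `ℙⁿ⁺¹_k` has an affine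
neighbourhood on which `ι.ker` is generated by one section) and which is not an isomorphism. Then
`dim H = n`: on an affine open `U` meeting `H` with `ι.ker(U) = (g)`, `Γ(H, ι⁻¹U) ≅ Γ(U) ⧸ (g)` with `Γ(U)` an
affine `k`-domain of dimension `n + 1`, `g ≠ 0` (as `H ≠ ℙⁿ⁺¹_k` has dimension `< n + 1`) and `g` a non-unit,
so Krull's principal ideal theorem gives dimension `n` (Hartshorne I Prop. 1.13 / Görtz–Wedhorn I Thm. 5.32,
affine-locally). [cite: GortzWedhorn2020, Thm. 5.22 and Thm. 5.32] -/
theorem topologicalKrullDim_of_hypersurface {k : Type u} [Field k] {n : ℕ} {H : Scheme.{u}} [IsIntegral H]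
    (ι : H ⟶ (projectiveSpace (n + 1) k).left) [IsClosedImmersion ι]
    (hloc : ∀ y : (projectiveSpace (n + 1) k).left, ∃ U : (projectiveSpace (n + 1) k).left.affineOpens,
      y ∈ (U : (projectiveSpace (n + 1) k).left.Opens) ∧ (ι.ker.ideal U).IsPrincipal)
    (hι : ¬ IsIso ι) : topologicalKrullDim H = (n : ℕ) := by
  haveI hint : IsIntegral (projectiveSpace (n + 1) k).left := isIntegral_projectiveSpace (n + 1) k
  haveI : IsProper (projectiveSpace (n + 1) k).hom := isProper_projectiveSpace (n + 1) k
  haveI : SmoothOfRelativeDimension (n + 1) (projectiveSpace (n + 1) k).hom :=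
    (isSmoothProjective_projectiveSpace_holds k (n + 1)).smoothOfRelativeDimension
  have hdimP : topologicalKrullDim ↥(projectiveSpace (n + 1) k).left = ((n + 1 : ℕ) : WithBot ℕ∞) :=
    topologicalKrullDim_eq_of_smoothOfRelativeDimension (projectiveSpace (n + 1) k).hom (n + 1)
  let f : H ⟶ Spec (.of k) := ι ≫ (projectiveSpace (n + 1) k).hom
  -- `H` is a proper closed subscheme: `dim H < n + 1`
  have hlt : topologicalKrullDim H < ((n + 1 : ℕ) : WithBot ℕ∞) := by
    by_contra h
    exact hι (isIso_of_isClosedImmersion_projectiveSpace_of_not_dim_lt ι h)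
  -- a point of `H` and an affine open of `ℙⁿ⁺¹_k` around it on which the ideal of `H` is principal
  obtain ⟨x⟩ := (inferInstance : Nonempty H)
  obtain ⟨U, hxU, hU⟩ := hloc (ι x)
  obtain ⟨g, hg⟩ := hU
  change ι.ker.ideal U = Ideal.span {g} at hg
  -- `Γ(ℙⁿ⁺¹, U)` is an affine `k`-domain of dimension `n + 1`
  have hUne : ((U : (projectiveSpace (n + 1) k).left.Opens) : Set (projectiveSpace (n + 1) k).left).Nonempty :=
    ⟨ι x, hxU⟩
  haveI : Nonempty (U : (projectiveSpace (n + 1) k).left.Opens) := ⟨⟨ι x, hxU⟩⟩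
  have hdimA : ringKrullDim Γ((projectiveSpace (n + 1) k).left, U) = ((n + 1 : ℕ) : WithBot ℕ∞) :=
    (topologicalKrullDim_eq_ringKrullDim_of_isAffineOpen (projectiveSpace (n + 1) k).hom U.2 hUne).symm.trans
      hdimP
  let ιk : k →+* Γ(Spec (CommRingCat.of k), ⊤) := (Scheme.ΓSpecIso (CommRingCat.of k)).inv.hom
  let φU : k →+* Γ((projectiveSpace (n + 1) k).left, U) :=
    ((projectiveSpace (n + 1) k).hom.appLE ⊤ U le_top).hom.comp ιk
  letI algU : Algebra k Γ((projectiveSpace (n + 1) k).left, U) := φU.toAlgebra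
  haveI : Algebra.FiniteType k Γ((projectiveSpace (n + 1) k).left, U) := by
    have h1 : ((projectiveSpace (n + 1) k).hom.appLE ⊤ U le_top).hom.FiniteType :=
      (projectiveSpace (n + 1) k).hom.finiteType_appLE (isAffineOpen_top _) U.2 le_top
    have h2 : ιk.FiniteType :=
      RingHom.FiniteType.of_surjective _
        (Scheme.ΓSpecIso (CommRingCat.of k)).symm.commRingCatIsoToRingEquiv.surjective
    exact h1.comp h2
  -- the affine open `ι⁻¹U ∋ x` of `H` computes `dim H`, and `Γ(H, ι⁻¹U) ≅ Γ(ℙⁿ⁺¹, U) ⧸ (g)`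
  have hV : IsAffineOpen (ι ⁻¹ᵁ (U : (projectiveSpace (n + 1) k).left.Opens)) := U.2.preimage ι
  have hVne : ((ι ⁻¹ᵁ (U : (projectiveSpace (n + 1) k).left.Opens) : H.Opens) : Set H).Nonempty := ⟨x, hxU⟩
  haveI : Nonempty (ι ⁻¹ᵁ (U : (projectiveSpace (n + 1) k).left.Opens) : H.Opens) := ⟨⟨x, hxU⟩⟩
  have hdimH : topologicalKrullDim H =
      ringKrullDim Γ(H, ι ⁻¹ᵁ (U : (projectiveSpace (n + 1) k).left.Opens)) :=
    topologicalKrullDim_eq_ringKrullDim_of_isAffineOpen f hV hVne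
  have hsurj : Function.Surjective (ι.app (U : (projectiveSpace (n + 1) k).left.Opens)).hom :=
    ι.app_surjective _ U.2
  have hker : Ideal.span {g} = RingHom.ker (ι.app (U : (projectiveSpace (n + 1) k).left.Opens)).hom := by
    rw [← hg, Scheme.Hom.ker_apply]
  let e : Γ((projectiveSpace (n + 1) k).left, U) ⧸ Ideal.span {g} ≃+*
      Γ(H, ι ⁻¹ᵁ (U : (projectiveSpace (n + 1) k).left.Opens)) :=
    (Ideal.quotEquivOfEq hker).trans (RingHom.quotientKerEquivOfSurjective hsurj)
  have hdimq : topologicalKrullDim H = ringKrullDim (Γ((projectiveSpace (n + 1) k).left, U) ⧸ Ideal.span {g}) :=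
    hdimH.trans (ringKrullDim_eq_of_ringEquiv e.symm)
  -- `g ≠ 0`: otherwise `dim H = dim Γ(ℙⁿ⁺¹, U) = n + 1`
  have hg0 : g ≠ 0 := by
    rintro rfl
    have h0 : ringKrullDim (Γ((projectiveSpace (n + 1) k).left, U) ⧸
        Ideal.span {(0 : Γ((projectiveSpace (n + 1) k).left, U))}) =
        ringKrullDim Γ((projectiveSpace (n + 1) k).left, U) :=
      ringKrullDim_eq_of_ringEquiv
        ((Ideal.quotEquivOfEq (Ideal.span_singleton_eq_bot.mpr rfl)).trans (RingEquiv.quotientBot _))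
    rw [hdimq, h0, hdimA] at hlt
    exact lt_irrefl _ hlt
  -- `g` is not a unit: `Γ(H, ι⁻¹U)` is a domain, in particular non-trivial
  have hgu : ¬ IsUnit g := by
    intro hu
    have htop : Ideal.span {g} = ⊤ := Ideal.span_singleton_eq_top.mpr hu
    haveI : Subsingleton (Γ((projectiveSpace (n + 1) k).left, U) ⧸ Ideal.span {g}) :=
      Ideal.Quotient.subsingleton_iff.mpr htop
    haveI : Subsingleton Γ(H, ι ⁻¹ᵁ (U : (projectiveSpace (n + 1) k).left.Opens)) :=
      e.symm.toEquiv.subsingleton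
    exact false_of_nontrivial_of_subsingleton Γ(H, ι ⁻¹ᵁ (U : (projectiveSpace (n + 1) k).left.Opens))
  rw [hdimq]
  exact ringKrullDim_quotient_span_singleton_eq_of_finiteType k n hdimA hg0 hgu

/-! ## Desingularizations in Temkin's format give regular blow-up models -/

/-- A desingularization in Temkin's format (`Scheme.AdmitsDesingularization`: ONE blow-up with centre in the
singular locus and regular source, Temkin 2008 Def. 2.2.6) of an INTEGRAL scheme is a regular blow-up model
in the sense of skeleton v10: its ideal sheaf `𝔞` is non-zero (the generic point is regular and off the
centre, `genericPoint_mem_regularLocus`) and every blow-up of `𝔞` is regular (blow-ups are unique up to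
isomorphism, `IsBlowup.unique`). [cite: Temkin2008, Def. 2.2.6] [cite: GortzWedhorn2020, (13.19) p. 413] -/
theorem blowupModel_of_admitsDesingularization {X : Scheme.{u}} [IsIntegral X]
    (h : Scheme.AdmitsDesingularization X) :
    ∃ 𝔞 : X.IdealSheafData, 𝔞 ≠ ⊥ ∧
      ∀ (Z : Scheme.{u}) (π : Z ⟶ X), IsBlowup π 𝔞 → Scheme.IsRegular Z := by
  obtain ⟨X', π, ⟨J, hJ, hsupp⟩, hreg⟩ := h
  refine ⟨J, ?_, fun Z π' hπ' => ?_⟩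
  · rintro rfl
    have hmem : genericPoint X ∈ ((⊥ : X.IdealSheafData).support : Set X) := by
      rw [Scheme.IdealSheafData.support_bot]; trivial
    exact hsupp hmem (genericPoint_mem_regularLocus X)
  · obtain ⟨e, -, -⟩ := hJ.unique hπ'
    exact hreg.of_iso e.hom

/-! ## The stub -/

/-- **STUB `stub_blowupModel_four`** of skeleton v10 (`n = 4`, threefolds), as `stub_blowupModel_four_of_CP`:
CONDITIONAL on the named facts `CossartPiltant2019General` (Cossart–Piltant 2019, Thm. 1.1 (i)(ii): a quasi-
excellent reduced separated Noetherian scheme of dimension `≤ 3` has a proper resolution which is an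
isomorphism over its regular locus) and `CossartPiltant2019Principalization` (Cossart–Piltant 2019, Prop. 4.4:
principalization of non-zero ideal sheaves on regular excellent threefolds by blow-ups in regular centres) —
published theorems, not proved in the tree, supplied as the first two arguments, after which the type is the
registered signature verbatim. For every integral closed `H ⊆ ℙ⁴_k` (`k` algebraically closed of characteristic
`p`; only "`k` a field" is used) with locally principal ideal there is a non-zero ideal sheaf `𝔞` on `H` all of
whose blow-ups are regular: if `ι` is an isomorphism, `H ≅ ℙ⁴_k` is regular and `𝔞 = ⊤`; otherwise `H` is an
integral hypersurface of dimension `3` (`topologicalKrullDim_of_hypersurface`), separated and of finite type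
over `k`, so `Picover.KernelReduction.admitsDesingularization_of_dim_three` (CP Thm. 1.1 + Raynaud–Gruson
domination (tree theorem) + CP Prop. 4.4 + Stacks 080B) gives one `Sing H`-supported blow-up with regular source,
which is a regular blow-up model (`blowupModel_of_admitsDesingularization`). [OURS · L1 W4.5b]
[cite: CossartPiltant2019, Thm. 1.1 (i)(ii); Prop. 4.4] [cite: StacksProject, Tag 081T; Tag 080B] -/
theorem stub_blowupModel_four_of_CP (hCP : CossartPiltant2019General.{0})
    (hPr : CossartPiltant2019Principalization.{0}) : ∀ p : ℕ, p.Prime → ∀ (k : Type) [Field k] [CharP k p] [IsAlgClosed k] (n : ℕ) (H : AlgebraicGeometry.Scheme.{0}) (ι : H ⟶ (Literature.AlgebraicGeometry.Motives.projectiveSpace n k).left), AlgebraicGeometry.IsClosedImmersion ι → AlgebraicGeometry.IsIntegral H → (∀ y : (Literature.AlgebraicGeometry.Motives.projectiveSpace n k).left, ∃ U : (Literature.AlgebraicGeometry.Motives.projectiveSpace n k).left.affineOpens, y ∈ (U : (Literature.AlgebraicGeometry.Motives.projectiveSpace n k).left.Opens) ∧ (ι.ker.ideal U).IsPrincipal)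 → n = 4 → ∃ 𝔞 : H.IdealSheafData, 𝔞 ≠ ⊥ ∧ ∀ (Z : AlgebraicGeometry.Scheme.{0}) (π : Z ⟶ H), Literature.AlgebraicGeometry.Resolution.IsBlowup π 𝔞 → Literature.AlgebraicGeometry.Resolution.Scheme.IsRegular Z := by
  intro _ _ k _ _ _ n H ι hι hH hloc hn
  subst hn
  by_cases hiso : IsIso ι
  · -- `H = ℙ⁴_k` is regular
    exact exists_blowupModel_of_isRegular
      (Scheme.IsRegular.of_iso (inv ι) (isRegular_projectiveSpace 4 k))
  · -- `H` is an integral hypersurface of dimension `3`: Cossart–Piltant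
    have hdim : topologicalKrullDim H = 3 := by
      rw [topologicalKrullDim_of_hypersurface (n := 3) ι hloc hiso]; rfl
    haveI : IsProper (projectiveSpace 4 k).hom := isProper_projectiveSpace 4 k
    exact blowupModel_of_admitsDesingularization
      (Summit.ResolutionOfSingularities.ResolutionOfSingularities.Theorems.Picover.KernelReduction.admitsDesingularization_of_dim_three
        hCP hPr (isExcellentRing_of_field k) H (ι ≫ (projectiveSpace 4 k).hom) hdim)

end Summit.ResolutionOfSingularities.ResolutionOfSingularities.Cruxes.EquisingularLift.StrataSplit

end
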